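import Mathlib
import Summits.KontsevichZagierPeriods.Zeta5Search.Families.BasicGrowthBounds
import Summits.KontsevichZagierPeriods.Zeta5Search.Families.BasicGrowthRatio
import Summits.KontsevichZagierPeriods.Zeta5Search.Families.CellularVanishingMiddle
import HarnessLib

/-!
# ζ(5) search — Families: growth of the "vanishing in the middle" integrals `I_n` of [BrownZudilin2022, §12]

HONEST FRAMING: systematic search; no irrationality claim unless certified.  STRUCTURAL facts about the SIZE of the
integrals `I_n = ∫ f^n ω` of the configuration `(10,2,4,1,6,3,8,5,9,7)` [BrownZudilin2022, §12]
(`BrownZudilin2022.vimIntegral`, the Literature object; the basic cellular integrals of `vim10`, anchor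
`integral_vim`) — fam-brown9's VIM family.  Instances of `Families/BasicGrowth{,Bounds,Ratio}.lean`; nothing about
the arithmetic of `I_n` (its decomposition into zeta values, denominators, the order-4 recurrence) is touched.

* `convergent_vim10` — the seating is convergent (Brown's condition, from `brownConvergent_vim_iff`);
* **`vimSup := fSup vim10`**, `0 < vimSup ≤ 1/2` — the growth constant BY NAME;
* **`tendsto_vimIntegral_root`** — `I_n^{1/n} → vimSup` (an exact limit: the input `hℓ` of Nesterenko-type criteria,
  with no use of the recurrence); `tendsto_log_vimIntegral_div`;
* `vimIntegral_le_vimSup_pow` (`I_n ≤ vimSup^n I_0`), **`vimIntegral_le_half_pow`** (`I_n ≤ 2^{−n} I_0`),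
  `vimIntegral_strictAnti`;
* `vimIntegral_sq_le_mul` (log-convexity), `vimIntegral_ratio_mono`, **`vimIntegral_ratio_le_vimSup`** (every exactly
  computed ratio `I_{n+1}/I_n` is a certified lower bound of the growth constant), `tendsto_vimIntegral_ratio`.
Standard axioms only.
-/

noncomputable section

open MeasureTheory Set Finset Filter Topology

namespace Summit.KontsevichZagierPeriods.Zeta5Search.Families.Cellular

open Literature.NumberTheory.Irrationality

/-- `vim10` is a bijection of `Fin 10`. -/
theorem vim10_bijective : Function.Bijective vim10 := Finite.injective_iff_bijective.1 vim10_injective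

/-- The "vanishing in the middle" seating `(10,2,4,1,6,3,8,5,9,7)` is CONVERGENT in Brown's sense.
[Brown2016, App. 2 §10.2.6; BrownZudilin2022, §12] -/
theorem convergent_vim10 : Convergent vim10 :=
  (brownConvergent_basic_iff_convergent vim10_bijective le_rfl).1 ((brownConvergent_vim_iff 0).2 le_rfl)

/-- **The growth constant of the VIM family**: `vimSup = sup_S f_{vim10}`. [structural] -/
def vimSup : ℝ := fSup vim10

/-- `0 < vimSup`. -/
theorem vimSup_pos : 0 < vimSup := fSup_pos vim10 vim10_bijective

/-- `vimSup ≤ 1/2`. -/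
theorem vimSup_le_half : vimSup ≤ 1 / 2 := fSup_le_half vim10 vim10_bijective convergent_vim10 (by norm_num)

/-- `I_n` as the basic cellular integral of `vim10` (restating the anchor with the cast shape used below). -/
theorem vimIntegral_eq (n : ℕ) :
    BrownZudilin2022.vimIntegral n = integral vim10 (fun _ => (n : ℤ)) (fun _ => (n : ℤ)) := (integral_vim n).symm

/-- **`I_n^{1/n} → vimSup`** (exact root limit of the VIM integrals). -/
theorem tendsto_vimIntegral_root :
    Tendsto (fun n : ℕ => (BrownZudilin2022.vimIntegral n) ^ (1 / (n : ℝ))) atTop (𝓝 vimSup) := by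
  simp only [vimIntegral_eq]
  exact tendsto_integral_basic_root vim10 vim10_bijective convergent_vim10

/-- `(log I_n)/n → log vimSup`. -/
theorem tendsto_log_vimIntegral_div :
    Tendsto (fun n : ℕ => Real.log (BrownZudilin2022.vimIntegral n) / n) atTop (𝓝 (Real.log vimSup)) := by
  simp only [vimIntegral_eq]
  exact tendsto_log_integral_basic_div vim10 vim10_bijective convergent_vim10

/-- `I_n ≤ vimSup^n · I_0`. -/
theorem vimIntegral_le_vimSup_pow (n : ℕ) :
    BrownZudilin2022.vimIntegral n ≤ vimSup ^ n * BrownZudilin2022.vimIntegral 0 := by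
  rw [vimIntegral_eq, vimIntegral_eq, Nat.cast_zero]
  exact integral_basic_le_fSup_pow vim10 vim10_bijective n

/-- **`I_n ≤ 2^{−n} · I_0`**: the VIM integrals decay at least geometrically with ratio `1/2`. -/
theorem vimIntegral_le_half_pow (n : ℕ) :
    BrownZudilin2022.vimIntegral n ≤ (1 / 2) ^ n * BrownZudilin2022.vimIntegral 0 := by
  rw [vimIntegral_eq, vimIntegral_eq, Nat.cast_zero]
  exact integral_basic_le_half_pow vim10 vim10_bijective convergent_vim10 (by norm_num) n

/-- The VIM integrals decrease strictly. -/
theorem vimIntegral_strictAnti : StrictAnti BrownZudilin2022.vimIntegral := by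
  have h := integral_basic_strictAnti vim10 vim10_bijective convergent_vim10 (by norm_num)
  intro m n hmn
  rw [vimIntegral_eq, vimIntegral_eq]
  exact h hmn

/-- Log-convexity: `I_{n+1}² ≤ I_n · I_{n+2}`. -/
theorem vimIntegral_sq_le_mul (n : ℕ) :
    BrownZudilin2022.vimIntegral (n + 1) ^ 2 ≤ BrownZudilin2022.vimIntegral n * BrownZudilin2022.vimIntegral (n + 2) := by
  rw [vimIntegral_eq, vimIntegral_eq, vimIntegral_eq]
  exact integral_basic_sq_le_mul vim10 vim10_bijective convergent_vim10 n

/-- The ratios `I_{n+1}/I_n` are non-decreasing. -/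
theorem vimIntegral_ratio_mono :
    Monotone fun n : ℕ => BrownZudilin2022.vimIntegral (n + 1) / BrownZudilin2022.vimIntegral n := by
  have h := integral_basic_ratio_mono vim10 vim10_bijective convergent_vim10
  intro m n hmn
  simp only [vimIntegral_eq]
  exact h hmn

/-- **Every ratio `I_{n+1}/I_n` is a lower bound of the growth constant `vimSup`.** -/
theorem vimIntegral_ratio_le_vimSup (n : ℕ) :
    BrownZudilin2022.vimIntegral (n + 1) / BrownZudilin2022.vimIntegral n ≤ vimSup := by
  rw [vimIntegral_eq, vimIntegral_eq]
  exact integral_basic_ratio_le_fSup vim10 vim10_bijective convergent_vim10 n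

/-- **The ratio limit**: `I_{n+1}/I_n → vimSup`. -/
theorem tendsto_vimIntegral_ratio :
    Tendsto (fun n : ℕ => BrownZudilin2022.vimIntegral (n + 1) / BrownZudilin2022.vimIntegral n) atTop (𝓝 vimSup) := by
  simp only [vimIntegral_eq]
  exact tendsto_integral_basic_ratio vim10 vim10_bijective convergent_vim10

end Summit.KontsevichZagierPeriods.Zeta5Search.Families.Cellular
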